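import Mathlib
import Summits.NavierStokesRegularity.NavierStokesRegularity.Theses.FilamentSkeletonRss
import Literature.Analysis.FluidPDE.PineauVicolRDSSLeray
import Summits.NavierStokesRegularity.NavierStokesRegularity.Theorems.CorkscrewDynamoClassicalCorkscrewSuffices
import Summits.NavierStokesRegularity.NavierStokesRegularity.Theorems.FilamentSkeletonRssCoreGluingClassicalOfProfile
import Summits.NavierStokesRegularity.NavierStokesRegularity.Theorems.FilamentSkeletonRssCoreGluingRssPackaging

/-!
# Route FilamentSkeletonRss · crux `CoreGluing` (stmt-NavierStokesRegularity-15401) — line `Sketch`, skeleton (lead c2, cycle 3; stubs unchanged from lead c1)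

`CoreGluing := SkeletonEquilibrium → RssProfileExists`. The skeleton isolates the new mathematics in ONE
stub and makes the two bookkeeping steps separate registered stubs:

* `stub_rssProfileFromSkeleton` (NEW MATHEMATICS; the crux proper, OPEN): a skeleton family as in
  `SkeletonEquilibrium` desingularises to a smooth, nontrivial solution `(U, P)` of Perelman's rotated
  Leray profile system (Pineau–Vicol (1.8a–b), the tree's shape of `rss_profile_system`)
  `α(JU − DU[Jy]) + ½U + ½DU[y] − ΔU + DU[U] + ∇P = 0`, `∇·U = 0`, with the profile Type-I decay
  `|U(y)| ≤ C₀/(1+|y|)` and a bounded profile pressure `|P| ≤ M`. As typed, the hypothesis exports no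
  Γ-uniform bounds, no ellipticity and no non-degeneracy (Cruxes/CoreGluing/Disproof.lean, design remark), so
  this stub is the RSS existence problem itself (¬ Tsai Conj. 8.9 / Pineau–Vicol Conj. 1.1 in the window) in
  classical form — crux-sized.
* `stub_classicalOfProfile` (dictionary, LANDED p129518) and `stub_rssPackaging` (packaging, LANDED p129205);
  their composition `stub_rssProfileExists_of_profile` (LANDED p130189): ONE such profile gives `RssProfileExists`.

`CoreGluing_of` composes the three stubs by name.

Tool stubs landed around the open stub (all `--supports stmt-NavierStokesRegularity-15401`, Theorems/FilamentSkeletonRssCoreGluing*.lean):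
c0 — AccretionBudgetZeroMean p129880, OutgoingEnvelopeBound p130029, CoreAreaFuchsianRigidity p130113,
AccretionBudgetRigidity p130322, InviscidEndNeutralMode p130349, SweptResonanceBound p130356;
c1 wave 1 — ProfileRotationCovariance p131903 (rotation about e₃ maps profile solutions to profile solutions: the
symmetry of the Lyapunov–Schmidt step), OutwardTransportEnvelope p131978 (e^{s/2}‖V(Φ_s y)‖ ≤ ‖V y‖ + ∫ e^{σ/2}‖LV‖ along
the spiral characteristics: Type-I envelope propagation), EllipticDatumSlipModel p131782 + EllipticDatumSlipCertificate
p131876 + EllipticDatumStrainModel p132057 + EllipticDatumStrainCertificate p132128 (kernel-certified ELLIPTIC supercritical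
C₄ skew-line datum D*: P₀=(−2,−3/2,−2), e₀=(6,3,2)/7, α=1, γ/2π=1 — unique stagnation point in (3/2,8/5), slope ≥ 2,
cross strain ≤ −1/10: Burgers-dressing precondition λ<1 holds, λ(t*)≈0.38);
c1 wave 2 — EllipticDatumRegularisedSlip p132384 + EllipticDatumSlipLimit p132513 (finite-Γ regularised slip of D* and its
inner limit: D* is a drop-in datum for a quantitative skeleton theorem), SiblingDatumStrainModel p132371 +
SiblingDatumHyperbolic p132466 (the sibling crux's K1 line datum, stmt-15400, is HYPERBOLIC at its stagnation core:
strain +0.07‖v‖² in direction (5,−3,4) ⇒ λ>1, not Burgers-dressable).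
-/

noncomputable section

namespace Summit.NavierStokesRegularity.NavierStokesRegularity.Theorems

open Set Function Filter MeasureTheory
open Literature.Analysis.FluidPDE Literature.Analysis.FluidPDE.PineauVicol2026
open scoped RealInnerProductSpace Laplacian ContDiff Topology

/-- **Stub 1 (new mathematics — the crux proper).** A filament skeleton as in `SkeletonEquilibrium`
desingularises into a smooth nontrivial solution `(U, P)` of the rotated Leray profile system with angular
speed `α ≠ 0`, profile Type-I decay `‖U y‖ ≤ C₀/(1+‖y‖)` and bounded pressure. -/
theorem stub_rssProfileFromSkeleton :
    Summit.NavierStokesRegularity.NavierStokesRegularity.Theses.FilamentSkeletonRss.SkeletonEquilibrium →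
    ∃ (α C₀ M : ℝ) (U : EuclideanSpace ℝ (Fin 3) → EuclideanSpace ℝ (Fin 3))
      (P : EuclideanSpace ℝ (Fin 3) → ℝ), α ≠ 0 ∧ U ≠ 0 ∧ ContDiff ℝ (⊤ : ℕ∞) U ∧ ContDiff ℝ (⊤ : ℕ∞) P ∧
      VectorCalculus.IsDivFree U ∧
      (∀ y : EuclideanSpace ℝ (Fin 3), α • (rotGen (U y) - fderiv ℝ U y (rotGen y)) + (1 / 2 : ℝ) • U y +
        (1 / 2 : ℝ) • fderiv ℝ U y y - (Δ U) y + fderiv ℝ U y (U y) + gradient P y = 0) ∧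
      (∀ y : EuclideanSpace ℝ (Fin 3), ‖U y‖ ≤ C₀ / (1 + ‖y‖)) ∧
      (∀ y : EuclideanSpace ℝ (Fin 3), |P y| ≤ M) := by
  sorry

/-- **Composition.** `CoreGluing` from the three stubs: the skeleton gives the profile (stub 1), the profile
gives a classical solution on the past with bounded pressure (stub 2), which packages into
`RssProfileExists` (stub 3). -/
theorem CoreGluing_of :
    Summit.NavierStokesRegularity.NavierStokesRegularity.Theses.FilamentSkeletonRss.CoreGluing := by
  intro hK1
  obtain ⟨α, C₀, M, U, P, hα, hU0, hU, hP, hdiv, heq, hdec, hPM⟩ := stub_rssProfileFromSkeleton hK1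
  obtain ⟨p, hcl, hp⟩ := stub_classicalOfProfile α M U P hU hP hdiv heq hPM
  exact stub_rssPackaging α C₀ U p hα (hU.of_le (by norm_cast)) hU0 hcl hp hdec

end Summit.NavierStokesRegularity.NavierStokesRegularity.Theorems
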